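import Literature.NumberTheory.EllipticCurves.ModularCurveEtaQuotientsProofs
import Literature.NumberTheory.EllipticCurves.CuspFormLFunctionFrickeProofs
import Literature.Geometry.Kaehler.RiemannSurfaceAbelTheoremChains
import HarnessLib

/-!
# The `η`-FRICKE LAW at weight 2: `(∏_δ η(δτ)^{r_δ}) ∣₂ w_N = −(N/√∏_δ δ^{r_δ}) · ∏_δ η((N/δ)τ)^{r_δ}`

Cell `bsd-f2-manin`, route `ManinLocalTwoThree`, crux C2 `ManinOddAtFour` (stmt-BirchSwinnertonDyer-22967; `--supports` helper):
an g51's sketch `Sketch-an-g51-EtaFricke.lean` (`b01bc0d6ef85a522`) landed verbatim by LEAD p1 g24 (namespace moved under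
`…Theorems.ManinLocalTwoThree.EtaFricke`); the one level-free lemma the FRICKE SIEVE of the level-`52` pinning consumes.  For an exponent vector `r` on the
divisors of `N` with `Σ_δ r_δ = 4` (weight `2`), the Fricke matrix `w_N = (0 −1; N 0)` (tree `frickeGL`,
`w_N • τ = −1/(Nτ)`, `det w_N = N`) acts on the `η`-quotient `g_r = ∏_{δ∣N} η(δτ)^{r_δ}` (tree `etaQuotient N r`)
by REFLECTING the exponent vector, `r^σ_δ = r_{N/δ}`, up to the explicit constant
`−K`, `K = (1/N) ∏_δ √(N/δ)^{r_δ} = N/√(∏_δ δ^{r_δ})` (Mathlib's slash normalisation `det^{k−1}·(cτ+d)^{−k}`):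

* `etaQuotient_frickeGL_smul` : `g_r(w_N τ) = −(∏_δ √(N/δ)^{r_δ}) · τ² · g_{r^σ}(τ)` — from Mathlib's
  `η(−1/z) = (√i)⁻¹ √z η(z)` (`eta_comp_eq_csqrt_I_inv`) at the points `z = (N/δ)τ`, the principal-branch
  splitting `√((N/δ)τ) = √(N/δ)·√τ` (tree `csqrt_mul_csqrt_of_pos`), `(e^{−iπ/4})⁴ = −1`, `(√τ)⁴ = τ²`, and the
  reindexing `δ ↦ N/δ` of the divisors (`Nat.prod_div_divisors`);
* `etaQuotient_slash_frickeGL` : `g_r ∣[2] w_N = (−K) • g_{r^σ}`;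
* `etaFrickeConst_eq_of_sq` : the rational certificate `c > 0 ∧ c²·∏_δ δ^{r_δ} = N² ⟹ K = c` (so `K` is read
  off Newman's square condition: `∏ δ^{r_δ} = t²`, `K = N/t`).

No multiplier system, no Petersson–Knopp formula is needed (only `S`).  At level 52 this gives the ten rows
`Cᵢ ∣₂ w₅₂ = κᵢ · C_{σ(i)}` of the `σ`-closed basis (`κ ∈ {−1, −1, −1/16, −16, −13/16, −16/13, −¼, −4, −¼, −4}`,
numerically certified in `HOME/an/g51/scripts/l52c.out`).  Sorry-free over the standard axioms; nothing here proves C2,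
Manin's conjecture or BSD.  [cite: DiamondShurman2005, §5.10] [cite: Koehler2011, Ch. 2] (the reflection rule is classical;
the proof here is self-contained from Mathlib's `S`-law).
-/

set_option autoImplicit false
-- lint-debt: the directory name repeats the summit name (sibling precedent `ManinLocalTwoThreeRatioBridge.lean`)
set_option linter.dupNamespace false

noncomputable section

open UpperHalfPlane hiding I
open ModularForm Complex Filter CongruenceSubgroup
open scoped MatrixGroups Real ModularForm Topology
open Literature.NumberTheory.EllipticCurves.ModularForms

namespace Summit.BirchSwinnertonDyer.BirchSwinnertonDyer.Theorems.ManinLocalTwoThree.EtaFricke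

/-- The reflected exponent vector `r^σ_δ = r_{N/δ}`. [folklore] -/
def frickeExp (N : ℕ) (r : ℕ → ℤ) : ℕ → ℤ := fun δ ↦ r (N / δ)

/-- The Fricke constant `K = (1/N) ∏_{δ ∣ N} √(N/δ)^{r_δ}` (`= N/√∏δ^{r_δ}` when `Σ r_δ = 4`). [folklore] -/
def etaFrickeConst (N : ℕ) (r : ℕ → ℤ) : ℝ :=
  ((N : ℝ))⁻¹ * ∏ δ ∈ N.divisors, Real.sqrt ((N / δ : ℕ) : ℝ) ^ r δ


/-- `√(e·τ) = √e · √τ` for a positive integer `e` and `τ ∈ ℍ` (principal branches). [folklore] -/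
theorem csqrt_natMul (τ : ℍ) {e : ℕ} (he : 0 < e) :
    Complex.sqrt ((e : ℂ) * τ) = ((Real.sqrt e : ℝ) : ℂ) * Complex.sqrt τ := by
  have h := csqrt_mul_csqrt_of_pos τ (le_refl (0 : ℝ)) (show (0 : ℝ) < e by exact_mod_cast he)
  rw [Complex.ofReal_zero, neg_zero, zero_div, zero_add, sub_zero,
    csqrt_ofReal_pos (show (0 : ℝ) < e by exact_mod_cast he), Complex.ofReal_natCast] at h
  exact h.symm

/-- `η(−1/(eτ)) = e^{−iπ/4} · √e · √τ · η(eτ)` for a positive integer `e` (Mathlib `eta_comp_eq_csqrt_I_inv` at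
`z = eτ`). [folklore] -/
theorem eta_neg_inv_natMul (τ : ℍ) {e : ℕ} (he : 0 < e) :
    η (-((e : ℂ) * τ)⁻¹) = cexp (-(π * I / 4)) * ((Real.sqrt e : ℝ) : ℂ) * Complex.sqrt τ * η ((e : ℂ) * τ) := by
  have hz : 0 < ((e : ℂ) * (τ : ℂ)).im := by simpa using mul_pos (Nat.cast_pos.mpr he) τ.2
  have h : η (-((e : ℂ) * τ)⁻¹) = (Complex.sqrt I)⁻¹ * (Complex.sqrt ((e : ℂ) * τ) * η ((e : ℂ) * τ)) := by
    simpa [neg_div] using eta_comp_eq_csqrt_I_inv hz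
  rw [h, csqrt_I_inv, csqrt_natMul τ he]; ring

variable (N : ℕ) [NeZero N]

/-- **The value of an `η`-quotient at `w_N τ`** (weight 2, `Σ r_δ = 4`):
`g_r(−1/(Nτ)) = −(∏_δ √(N/δ)^{r_δ}) · τ² · g_{r^σ}(τ)`. [folklore] -/
theorem etaQuotient_frickeGL_smul (r : ℕ → ℤ) (hr : ∑ δ ∈ N.divisors, r δ = 4) (τ : ℍ) :
    etaQuotient N r (glCast (frickeGL N : GL (Fin 2) ℚ) • τ) =
      -((∏ δ ∈ N.divisors, Real.sqrt ((N / δ : ℕ) : ℝ) ^ r δ : ℝ) : ℂ) * (τ : ℂ) ^ 2 *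
        etaQuotient N (frickeExp N r) τ := by
  rw [etaQuotient_apply, coe_frickeGL_smul]
  have hN0 : (N : ℂ) ≠ 0 := by exact_mod_cast NeZero.ne N
  have hτ0 : (τ : ℂ) ≠ 0 := ne_zero τ
  have key : ∀ δ ∈ N.divisors, η ((δ : ℂ) * -((N : ℂ) * τ)⁻¹) ^ r δ =
      cexp (-(π * I / 4)) ^ r δ * (((Real.sqrt ((N / δ : ℕ) : ℝ) : ℝ) : ℂ) ^ r δ *
        (Complex.sqrt τ ^ r δ * η (((N / δ : ℕ) : ℂ) * τ) ^ r δ)) := by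
    intro δ hδ
    have hδ0 : 0 < δ := Nat.pos_of_mem_divisors hδ
    have hdvd : δ ∣ N := Nat.dvd_of_mem_divisors hδ
    have he0 : 0 < N / δ := Nat.div_pos (Nat.le_of_dvd (NeZero.pos N) hdvd) hδ0
    have hδC : (δ : ℂ) ≠ 0 := by exact_mod_cast hδ0.ne'
    have harg : (δ : ℂ) * -((N : ℂ) * τ)⁻¹ = -((((N / δ : ℕ)) : ℂ) * τ)⁻¹ := by
      rw [Nat.cast_div hdvd hδC]
      field_simp
    rw [harg, eta_neg_inv_natMul τ he0, mul_zpow, mul_zpow, mul_zpow]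
    ring
  rw [Finset.prod_congr rfl key, Finset.prod_mul_distrib, Finset.prod_mul_distrib, Finset.prod_mul_distrib,
    Literature.Geometry.Kaehler.RiemannSurface.prod_zpow_eq_zpow_sum _ (Complex.exp_ne_zero _), hr]
  have hsq0 : Complex.sqrt (τ : ℂ) ≠ 0 := fun h ↦ hτ0 (by rw [← csqrt_sq (τ : ℂ), h]; simp)
  rw [Literature.Geometry.Kaehler.RiemannSurface.prod_zpow_eq_zpow_sum _ hsq0, hr]
  -- the phase: `(e^{−iπ/4})⁴ = e^{−iπ} = −1`
  have hphase : cexp (-(π * I / 4)) ^ (4 : ℤ) = -1 := by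
    rw [show (4 : ℤ) = ((4 : ℕ) : ℤ) from rfl, zpow_natCast, ← Complex.exp_nat_mul,
      show ((4 : ℕ) : ℂ) * -(π * I / 4) = -(π * I) by push_cast; ring, Complex.exp_neg, Complex.exp_pi_mul_I]
    norm_num
  -- `(√τ)⁴ = τ²`
  have hsq4 : Complex.sqrt (τ : ℂ) ^ (4 : ℤ) = (τ : ℂ) ^ 2 := by
    rw [show (4 : ℤ) = ((4 : ℕ) : ℤ) from rfl, zpow_natCast, show (4 : ℕ) = 2 * 2 from rfl, pow_mul, csqrt_sq]
  -- reindex the `η`-product by `δ ↦ N/δ`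
  have hre : ∏ δ ∈ N.divisors, η (((N / δ : ℕ) : ℂ) * τ) ^ r δ = etaQuotient N (frickeExp N r) τ := by
    rw [etaQuotient_apply, ← Nat.prod_div_divisors N (fun d ↦ η ((d : ℂ) * (τ : ℂ)) ^ frickeExp N r d)]
    refine Finset.prod_congr rfl fun δ hδ ↦ ?_
    simp only [frickeExp]
    rw [Nat.div_div_self (Nat.dvd_of_mem_divisors hδ) (NeZero.ne N)]
  rw [hphase, hsq4, hre]
  push_cast
  ring

/-- **The `η`-Fricke law at weight 2**: `g_r ∣[2] w_N = (−K) • g_{r^σ}`, `K = (1/N)∏_δ √(N/δ)^{r_δ}`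
(Mathlib slash normalisation: `(f ∣₂ γ)(τ) = f(γτ)·det γ·(cτ+d)⁻²`). [folklore] -/
theorem etaQuotient_slash_frickeGL (r : ℕ → ℤ) (hr : ∑ δ ∈ N.divisors, r δ = 4) :
    etaQuotient N r ∣[(2 : ℤ)] (glCast (frickeGL N : GL (Fin 2) ℚ) : GL (Fin 2) ℝ) =
      (-(etaFrickeConst N r : ℂ)) • etaQuotient N (frickeExp N r) := by
  ext τ
  have hN0 : (N : ℂ) ≠ 0 := by exact_mod_cast NeZero.ne N
  have hτ0 : (τ : ℂ) ≠ 0 := ne_zero τ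
  have hdet : |(glCast (frickeGL N : GL (Fin 2) ℚ) : GL (Fin 2) ℝ).det.val| = N := by
    rw [det_glCast_frickeGL]; exact abs_of_nonneg (Nat.cast_nonneg N)
  have hden : denom (glCast (frickeGL N : GL (Fin 2) ℚ) : GL (Fin 2) ℝ) τ = (N : ℂ) * τ := by
    rw [denom, val_glCast_frickeGL]
    simp
  rw [ModularForm.slash_apply, σ_glCast, hdet, hden, etaQuotient_frickeGL_smul N r hr τ, Pi.smul_apply,
    smul_eq_mul, etaFrickeConst]
  rw [show (2 : ℤ) - 1 = 1 by norm_num, zpow_one, zpow_neg, show (2 : ℤ) = ((2 : ℕ) : ℤ) from rfl, zpow_natCast]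
  push_cast
  field_simp

/-- **Certificate for the constant**: if `c > 0` and `c² · ∏_δ δ^{r_δ} = N²` (rational data: by Newman's
condition `∏ δ^{r_δ} = t²` one has `c = N/t`), then `K = c`. [folklore] -/
theorem etaFrickeConst_eq_of_sq (r : ℕ → ℤ) (hr : ∑ δ ∈ N.divisors, r δ = 4) {c : ℝ} (hc : 0 < c)
    (h : c ^ 2 * ∏ δ ∈ N.divisors, (δ : ℝ) ^ r δ = (N : ℝ) ^ 2) : etaFrickeConst N r = c := by
  have hN : (0 : ℝ) < N := by exact_mod_cast NeZero.pos N
  -- `K > 0`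
  have hpos : ∀ δ ∈ N.divisors, (0 : ℝ) < Real.sqrt ((N / δ : ℕ) : ℝ) := fun δ hδ ↦ by
    have he : 0 < N / δ :=
      Nat.div_pos (Nat.le_of_dvd (NeZero.pos N) (Nat.dvd_of_mem_divisors hδ)) (Nat.pos_of_mem_divisors hδ)
    exact Real.sqrt_pos.mpr (by exact_mod_cast he)
  have hK : 0 < etaFrickeConst N r :=
    mul_pos (inv_pos.mpr hN) (Finset.prod_pos fun δ hδ ↦ zpow_pos (hpos δ hδ) _)
  -- `K² = N² / ∏ δ^{r_δ}`:  `∏ (√(N/δ))^{2 r_δ} = ∏ (N/δ)^{r_δ} = N^{Σr} / ∏ δ^{r_δ}`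
  have hprod : (∏ δ ∈ N.divisors, Real.sqrt ((N / δ : ℕ) : ℝ) ^ r δ) ^ 2 * ∏ δ ∈ N.divisors, (δ : ℝ) ^ r δ =
      (N : ℝ) ^ 4 := by
    rw [← Finset.prod_pow, ← Finset.prod_mul_distrib]
    have : ∀ δ ∈ N.divisors, (Real.sqrt ((N / δ : ℕ) : ℝ) ^ r δ) ^ 2 * (δ : ℝ) ^ r δ = (N : ℝ) ^ r δ := by
      intro δ hδ
      have hδ0 : (0 : ℝ) < δ := by exact_mod_cast Nat.pos_of_mem_divisors hδ
      have hdvd : δ ∣ N := Nat.dvd_of_mem_divisors hδ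
      rw [← zpow_natCast, ← zpow_mul, mul_comm (r δ) _, zpow_mul, zpow_natCast, Real.sq_sqrt (Nat.cast_nonneg _),
        ← mul_zpow, Nat.cast_div hdvd hδ0.ne', div_mul_cancel₀ _ hδ0.ne']
    rw [Finset.prod_congr rfl this]
    have h4 : ∏ δ ∈ N.divisors, (N : ℝ) ^ r δ = (N : ℝ) ^ (∑ δ ∈ N.divisors, r δ) := by
      classical
      induction N.divisors using Finset.induction_on with
      | empty => simp
      | insert i t hi IH => rw [Finset.prod_insert hi, Finset.sum_insert hi, IH, zpow_add₀ hN.ne']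
    rw [h4, hr]
    norm_cast
  have hK2 : etaFrickeConst N r ^ 2 = c ^ 2 := by
    have hP : (0 : ℝ) < ∏ δ ∈ N.divisors, (δ : ℝ) ^ r δ :=
      Finset.prod_pos fun δ hδ ↦ zpow_pos (by exact_mod_cast Nat.pos_of_mem_divisors hδ) _
    have e1 : etaFrickeConst N r ^ 2 * ∏ δ ∈ N.divisors, (δ : ℝ) ^ r δ = (N : ℝ) ^ 2 := by
      unfold etaFrickeConst
      rw [mul_pow, mul_assoc, hprod]
      field_simp
    nlinarith [e1, h, hP]
  have h3 : (etaFrickeConst N r - c) * (etaFrickeConst N r + c) = 0 := by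
    have : etaFrickeConst N r ^ 2 - c ^ 2 = 0 := sub_eq_zero.mpr hK2
    linear_combination this
  rcases mul_eq_zero.mp h3 with h4 | h4
  · linarith
  · linarith

end Summit.BirchSwinnertonDyer.BirchSwinnertonDyer.Theorems.ManinLocalTwoThree.EtaFricke
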